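import Summits.ValiantsHypothesis.ValiantsHypothesis.Theorems.SymPencilAffineKernelLever
import Summits.ValiantsHypothesis.ValiantsHypothesis.Theorems.SymPencilSdcPerFourTwentySeven
import Mathlib.LinearAlgebra.Matrix.BilinearForm

/-!
# Route `SymPencil` — the cross space `V× = row 0 ⊕ k E₁₀ ⊕ k E₂₀` at size `27`, I: the `per_4`
# computations, the size-`27` count, and the lever's vanishing of the forms `C₁, C₂`
# (`--supports` stmt-ValiantsHypothesis-5674 `SdcSuperquadratic`; cell `(10,6,6)` of the size-`27`
# kernel-package table, rung currency only, nothing here bears on `VP ≠ VNP`)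

Tools for `SymPencilPerFourCrossSixFront.cross_front` (the front half of the pencil-side exclusion
of the cross space, the one `6`-dimensional singular subspace with a joint family of six squares,
`SymPencilPerFourSixDimJointSix`).  With `a = E₀₁ + E₀₂ + E₀₃` and `A = 𝟙𝟙ᵀ - 1`:

* `per_shift_cross`: translating by `p E₁₀ + q E₂₀` changes the cubic
  `F = per_4(· + t a) - per_4` by `t (p C₁ + q C₂)`, `C₁(x) = x₂'ᵀ A x₃'`, `C₂(x) = x₁'ᵀ A x₃'`;
  `eval_cross_pencil`: on `X₀ = {rows 1,2 on columns 1..3} ⊕ k E₃₀`,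
  `per_4 (t a + s x) = s³ t · x₃₀ · x₁'ᵀ A x₂'`.
* `rows_three_eq_zero_of_isotropic` (the size-`27` COUNT): a subspace of the complement
  coordinates of `V×` on which the polar forms of `C₁, C₂` vanish has dimension `≤ 7 - w`,
  `w = dim {x₃'}`; so dimension `≥ 7` forces `x₃' = 0`.
* `cross_forms_vanish`: by the affine lever (`SymPencilAffineKernelLever.shift_invariance_of_affine`)
  and `per_shift_cross`, `C₁(x) = C₂(x) = 0` whenever `(D + CL (t a))⁻¹ bL x ∈ D⁻¹ (im bL)`.
* `cross_form_eq` / `cross_form_polar` / `cross_a_off_row` / `eq_cross_of_rows_three`: bookkeeping.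

No definitions, no named facts. [folklore]
-/

noncomputable section

-- single-conjunct layout: Sub = Summit, duplicated namespace component intended
set_option linter.dupNamespace false

namespace Summit.ValiantsHypothesis.ValiantsHypothesis.Theorems.SymPencilPerFourCrossSixForms

open Matrix MvPolynomial Module
open Literature.Computability.AlgebraicComplexity
open Summit.ValiantsHypothesis.ValiantsHypothesis.Theorems.SymPencilLagrangianKernel
open Summit.ValiantsHypothesis.ValiantsHypothesis.Theorems.SymPencilAffineKernelLever
open Summit.ValiantsHypothesis.ValiantsHypothesis.Theorems.SymPencilSdcPerFourTwentySeven
open Literature.Computability.AlgebraicComplexity.AlperBogartVelasco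

universe u

variable {k : Type u} [Field k]

/-! ### The two `per_4` computations -/

/-- **Translation by `p E₁₀ + q E₂₀` changes `per_4 (· + t a) - per_4` by `t (p C₁ + q C₂)`**
(`a = E₀₁ + E₀₂ + E₀₃`). [folklore] -/
theorem per_shift_cross (x : Fin 4 × Fin 4 → k) (p q t : k) :
    MvPolynomial.eval (x + (fun z : Fin 4 × Fin 4 =>
        (Matrix.of ![![0, 0, 0, 0], ![p, 0, 0, 0], ![q, 0, 0, 0], ![0, 0, 0, 0]]) z.1 z.2) +
        t • (fun z : Fin 4 × Fin 4 =>
          (Matrix.of ![![0, 1, 1, 1], ![0, 0, 0, 0], ![0, 0, 0, 0], ![0, 0, 0, 0]]) z.1 z.2))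
        (perPoly (Fin 4) k) -
      MvPolynomial.eval (x + (fun z : Fin 4 × Fin 4 =>
        (Matrix.of ![![0, 0, 0, 0], ![p, 0, 0, 0], ![q, 0, 0, 0], ![0, 0, 0, 0]]) z.1 z.2))
        (perPoly (Fin 4) k) -
      (MvPolynomial.eval (x + t • (fun z : Fin 4 × Fin 4 =>
          (Matrix.of ![![0, 1, 1, 1], ![0, 0, 0, 0], ![0, 0, 0, 0], ![0, 0, 0, 0]]) z.1 z.2))
          (perPoly (Fin 4) k) - MvPolynomial.eval x (perPoly (Fin 4) k)) =
      t * (p * (x (2, 1) * (x (3, 2) + x (3, 3)) + x (2, 2) * (x (3, 1) + x (3, 3)) +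
          x (2, 3) * (x (3, 1) + x (3, 2))) +
        q * (x (1, 1) * (x (3, 2) + x (3, 3)) + x (1, 2) * (x (3, 1) + x (3, 3)) +
          x (1, 3) * (x (3, 1) + x (3, 2)))) := by
  simp only [eval_perPoly, Matrix.permanent_fin_four_row, Matrix.of_apply, Pi.add_apply,
    Pi.smul_apply, smul_eq_mul]
  simp
  ring

/-- **The pencil restricted to `X₀`**: `per_4 (t a + s x) = s³ · t · x₃₀ · x₁'ᵀ A x₂'` for `x`
supported on rows `1, 2` × columns `1..3` and the entry `(3,0)`. [folklore] -/
theorem eval_cross_pencil (ω : k) (r : Fin 2 × Fin 3 → k) (t s : k) :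
    MvPolynomial.eval (t • (fun z : Fin 4 × Fin 4 =>
          (Matrix.of ![![0, 1, 1, 1], ![0, 0, 0, 0], ![0, 0, 0, 0], ![0, 0, 0, 0]]) z.1 z.2) +
        s • (fun z : Fin 4 × Fin 4 => (Matrix.of ![![0, 0, 0, 0],
          ![0, r (0, 0), r (0, 1), r (0, 2)], ![0, r (1, 0), r (1, 1), r (1, 2)], ![ω, 0, 0, 0]])
          z.1 z.2)) (perPoly (Fin 4) k) =
      s ^ 3 * (t * (ω * (r (0, 0) * (r (1, 1) + r (1, 2)) + r (0, 1) * (r (1, 0) + r (1, 2)) +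
        r (0, 2) * (r (1, 0) + r (1, 1))))) := by
  simp only [eval_perPoly, Matrix.permanent_fin_four_row, Matrix.of_apply, Pi.add_apply,
    Pi.smul_apply, smul_eq_mul]
  simp
  ring

/-! ### The size-`27` count on the complement coordinates -/

/-- **The count.**  Let `S` be a subspace of the complement coordinates of `V×` (rows `0` and the
entries `(1,0), (2,0)` vanish) on which the polar forms of `C₁(x) = x₂'ᵀ A x₃'` and
`C₂(x) = x₁'ᵀ A x₃'` vanish (`A` symmetric invertible `3 × 3`).  If `dim S ≥ 7` then `x₃' = 0`
on `S`.  (Rank–nullity along `x ↦ x₃'`, `x ↦ A x₂'`, `x ↦ A x₁'`, `x ↦ x₃₀`: with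
`w = dim x₃'(S)` one gets `dim S ≤ w + 2(3 - w) + 1`.) [folklore] -/
theorem rows_three_eq_zero_of_isotropic (A : Matrix (Fin 3) (Fin 3) k)
    (hA : IsUnit A.det) (S : Submodule k (Fin 4 × Fin 4 → k))
    (hX : ∀ x ∈ S, ∀ z : Fin 4 × Fin 4, (z.1 = 0 ∨ z = (1, 0) ∨ z = (2, 0)) → x z = 0)
    (hP1 : ∀ x ∈ S, ∀ x' ∈ S,
      (fun l : Fin 3 => x' (3, l.succ)) ⬝ᵥ A *ᵥ (fun j : Fin 3 => x (2, j.succ)) +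
        (fun l : Fin 3 => x (3, l.succ)) ⬝ᵥ A *ᵥ (fun j : Fin 3 => x' (2, j.succ)) = 0)
    (hP2 : ∀ x ∈ S, ∀ x' ∈ S,
      (fun l : Fin 3 => x' (3, l.succ)) ⬝ᵥ A *ᵥ (fun j : Fin 3 => x (1, j.succ)) +
        (fun l : Fin 3 => x (3, l.succ)) ⬝ᵥ A *ᵥ (fun j : Fin 3 => x' (1, j.succ)) = 0)
    (h7 : 7 ≤ finrank k S) : ∀ x ∈ S, ∀ l : Fin 3, x (3, l.succ) = 0 := by
  classical
  -- the coordinate maps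
  set γ : (Fin 4 × Fin 4 → k) →ₗ[k] (Fin 3 → k) :=
    LinearMap.funLeft k k (fun l : Fin 3 => (((3 : Fin 4), l.succ) : Fin 4 × Fin 4)) with hγdef
  have hγ : ∀ x, γ x = fun l => x (3, l.succ) := fun x => rfl
  set ρ₁ : (Fin 4 × Fin 4 → k) →ₗ[k] (Fin 3 → k) :=
    A.mulVecLin ∘ₗ LinearMap.funLeft k k (fun j : Fin 3 => (((1 : Fin 4), j.succ) : Fin 4 × Fin 4))
    with hρ₁def
  have hρ₁ : ∀ x, ρ₁ x = A *ᵥ fun j => x (1, j.succ) := fun x => rfl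
  set ρ₂ : (Fin 4 × Fin 4 → k) →ₗ[k] (Fin 3 → k) :=
    A.mulVecLin ∘ₗ LinearMap.funLeft k k (fun j : Fin 3 => (((2 : Fin 4), j.succ) : Fin 4 × Fin 4))
    with hρ₂def
  have hρ₂ : ∀ x, ρ₂ x = A *ᵥ fun j => x (2, j.succ) := fun x => rfl
  set e₃₀ : (Fin 4 × Fin 4 → k) →ₗ[k] k := LinearMap.proj ((3 : Fin 4), (0 : Fin 4)) with he₃₀def
  have he₃₀ : ∀ x, e₃₀ x = x (3, 0) := fun x => rfl
  -- the image `W` of `x ↦ x₃'` and its dot-orthogonal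
  set W := S.map γ with hWdef
  set Bd : LinearMap.BilinForm k (Fin 3 → k) := Matrix.toBilin' (1 : Matrix (Fin 3) (Fin 3) k)
    with hBd
  have hBd_apply : ∀ v w : Fin 3 → k, Bd v w = v ⬝ᵥ w := fun v w => by
    rw [hBd, Matrix.toBilin'_apply', Matrix.one_mulVec]
  have hnd : Bd.Nondegenerate :=
    LinearMap.BilinForm.nondegenerate_toBilin'_of_det_ne_zero' _ (by simp)
  set Wp := Bd.orthogonal W with hWp
  have hWp_mem : ∀ c : Fin 3 → k, (∀ x' ∈ S, (fun l : Fin 3 => x' (3, l.succ)) ⬝ᵥ c = 0) →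
      c ∈ Wp := by
    intro c hc
    rw [hWp, LinearMap.BilinForm.mem_orthogonal_iff]
    rintro _ ⟨x', hx', rfl⟩
    show Bd (γ x') c = 0
    rw [hBd_apply, hγ]
    exact hc x' hx'
  have h3 : finrank k (Fin 3 → k) = 3 := by simp
  have hWle : finrank k W ≤ 3 := by
    have := Submodule.finrank_le W
    rwa [h3] at this
  have hWp_dim : finrank k Wp = 3 - finrank k W := by
    have := LinearMap.BilinForm.finrank_orthogonal hnd W
    rwa [h3] at this
  -- the chain of rank–nullity identities
  set S₀ := (S ⊓ LinearMap.ker γ : Submodule k (Fin 4 × Fin 4 → k)) with hS₀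
  set S₁ := (S₀ ⊓ LinearMap.ker ρ₂ : Submodule k (Fin 4 × Fin 4 → k)) with hS₁
  set S₂ := (S₁ ⊓ LinearMap.ker ρ₁ : Submodule k (Fin 4 × Fin 4 → k)) with hS₂
  have ha := AlperBogartVelasco.finrank_eq_finrank_map_add_finrank_inf_ker S γ
  have hb := AlperBogartVelasco.finrank_eq_finrank_map_add_finrank_inf_ker S₀ ρ₂
  have hc := AlperBogartVelasco.finrank_eq_finrank_map_add_finrank_inf_ker S₁ ρ₁
  have hd := AlperBogartVelasco.finrank_eq_finrank_map_add_finrank_inf_ker S₂ e₃₀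
  rw [← hS₀, ← hWdef] at ha
  rw [← hS₁] at hb
  rw [← hS₂] at hc
  -- `ρ₂ (S₀) ≤ W⊥`, `ρ₁ (S₁) ≤ W⊥`
  have hS₀_γ : ∀ x ∈ S₀, ∀ l : Fin 3, x (3, l.succ) = 0 := fun x hx l => by
    have h := (Submodule.mem_inf.1 hx).2
    rw [LinearMap.mem_ker, hγ] at h
    exact congr_fun h l
  have hb' : finrank k (S₀.map ρ₂) ≤ finrank k Wp := by
    apply Submodule.finrank_mono
    rintro _ ⟨x, hx, rfl⟩
    apply hWp_mem
    intro x' hx'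
    have h := hP1 x (Submodule.mem_inf.1 hx).1 x' hx'
    have hz : (fun l : Fin 3 => x (3, l.succ)) = 0 := funext (hS₀_γ x hx)
    rw [hz, zero_dotProduct, add_zero] at h
    rw [hρ₂]
    exact h
  have hc' : finrank k (S₁.map ρ₁) ≤ finrank k Wp := by
    apply Submodule.finrank_mono
    rintro _ ⟨x, hx, rfl⟩
    apply hWp_mem
    intro x' hx'
    have hx₀ : x ∈ S₀ := (Submodule.mem_inf.1 hx).1
    have h := hP2 x (Submodule.mem_inf.1 hx₀).1 x' hx'
    have hz : (fun l : Fin 3 => x (3, l.succ)) = 0 := funext (hS₀_γ x hx₀)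
    rw [hz, zero_dotProduct, add_zero] at h
    rw [hρ₁]
    exact h
  -- `x₃₀ (S₂)` has dimension `≤ 1` and `S₂ ∩ ker x₃₀ = 0`
  have hd' : finrank k (S₂.map e₃₀) ≤ 1 := by
    have := Submodule.finrank_le (S₂.map e₃₀)
    rwa [Module.finrank_self] at this
  have hinjA : Function.Injective A.mulVec :=
    Matrix.mulVec_injective_iff_isUnit.2 ((Matrix.isUnit_iff_isUnit_det A).2 hA)
  have he : (S₂ ⊓ LinearMap.ker e₃₀ : Submodule k (Fin 4 × Fin 4 → k)) = ⊥ := by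
    rw [Submodule.eq_bot_iff]
    intro x hx
    obtain ⟨hx2, hx30⟩ := Submodule.mem_inf.1 hx
    obtain ⟨hx1, hxρ₁⟩ := Submodule.mem_inf.1 hx2
    obtain ⟨hx0, hxρ₂⟩ := Submodule.mem_inf.1 hx1
    have hxS : x ∈ S := (Submodule.mem_inf.1 hx0).1
    rw [LinearMap.mem_ker, he₃₀] at hx30
    rw [LinearMap.mem_ker, hρ₁] at hxρ₁
    rw [LinearMap.mem_ker, hρ₂] at hxρ₂
    have hr1 : (fun j : Fin 3 => x (1, j.succ)) = 0 := hinjA (by rw [hxρ₁, Matrix.mulVec_zero])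
    have hr2 : (fun j : Fin 3 => x (2, j.succ)) = 0 := hinjA (by rw [hxρ₂, Matrix.mulVec_zero])
    have hr3 := hS₀_γ x hx0
    funext z
    obtain ⟨i, j⟩ := z
    rw [Pi.zero_apply]
    fin_cases i
    · exact hX x hxS _ (Or.inl rfl)
    · fin_cases j
      · exact hX x hxS _ (Or.inr (Or.inl rfl))
      · exact congr_fun hr1 0
      · exact congr_fun hr1 1
      · exact congr_fun hr1 2
    · fin_cases j
      · exact hX x hxS _ (Or.inr (Or.inr rfl))
      · exact congr_fun hr2 0
      · exact congr_fun hr2 1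
      · exact congr_fun hr2 2
    · fin_cases j
      · exact hx30
      · exact hr3 0
      · exact hr3 1
      · exact hr3 2
  rw [he, finrank_bot, add_zero] at hd
  -- count: `dim S ≤ w + 2 (3 - w) + 1 = 7 - w`, so `w = 0`
  have hW0 : finrank k W = 0 := by omega
  have hWbot : W = ⊥ := Submodule.finrank_eq_zero.1 hW0
  intro x hx l
  have hmem : γ x ∈ W := ⟨x, hx, rfl⟩
  rw [hWbot, Submodule.mem_bot, hγ] at hmem
  exact congr_fun hmem l

/-! ### The front theorem -/

/-- The quadratic `C₁`-type form as a dot product with `A = 𝟙𝟙ᵀ - 1`. [folklore] -/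
theorem cross_form_eq (x : Fin 4 × Fin 4 → k) (i : Fin 4) :
    x (i, 1) * (x (3, 2) + x (3, 3)) + x (i, 2) * (x (3, 1) + x (3, 3)) +
        x (i, 3) * (x (3, 1) + x (3, 2)) =
      (fun l : Fin 3 => x (3, l.succ)) ⬝ᵥ
        (Matrix.of ![![(0 : k), 1, 1], ![1, 0, 1], ![1, 1, 0]]) *ᵥ (fun j : Fin 3 => x (i, j.succ)) := by
  simp [dotProduct, Matrix.mulVec, Fin.sum_univ_three]
  ring

/-- Polarisation of the `C₁`-type form. [folklore] -/
theorem cross_form_polar (x x' : Fin 4 × Fin 4 → k) (i : Fin 4) :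
    (fun l : Fin 3 => (x + x') (3, l.succ)) ⬝ᵥ
        (Matrix.of ![![(0 : k), 1, 1], ![1, 0, 1], ![1, 1, 0]]) *ᵥ (fun j : Fin 3 => (x + x') (i, j.succ)) -
      (fun l : Fin 3 => x (3, l.succ)) ⬝ᵥ
        (Matrix.of ![![(0 : k), 1, 1], ![1, 0, 1], ![1, 1, 0]]) *ᵥ (fun j : Fin 3 => x (i, j.succ)) -
      (fun l : Fin 3 => x' (3, l.succ)) ⬝ᵥ
        (Matrix.of ![![(0 : k), 1, 1], ![1, 0, 1], ![1, 1, 0]]) *ᵥ (fun j : Fin 3 => x' (i, j.succ)) =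
      (fun l : Fin 3 => x' (3, l.succ)) ⬝ᵥ
        (Matrix.of ![![(0 : k), 1, 1], ![1, 0, 1], ![1, 1, 0]]) *ᵥ (fun j : Fin 3 => x (i, j.succ)) +
      (fun l : Fin 3 => x (3, l.succ)) ⬝ᵥ
        (Matrix.of ![![(0 : k), 1, 1], ![1, 0, 1], ![1, 1, 0]]) *ᵥ (fun j : Fin 3 => x' (i, j.succ)) := by
  simp [dotProduct, Matrix.mulVec, Fin.sum_univ_three]
  ring

/-- The direction `a = E₀₁ + E₀₂ + E₀₃` vanishes off row `0`. [folklore] -/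
theorem cross_a_off_row (t : k) (i j : Fin 4) (hi : i ≠ 0) :
    (t • fun z : Fin 4 × Fin 4 =>
      (Matrix.of ![![0, 1, 1, 1], ![0, 0, 0, 0], ![0, 0, 0, 0], ![0, 0, 0, 0]]) z.1 z.2) (i, j) =
      (0 : k) := by
  rw [Pi.smul_apply, smul_eq_mul]
  fin_cases i
  · exact absurd rfl hi
  all_goals fin_cases j <;> simp

variable [CharZero k] {ι' : Type*} [Fintype ι'] [DecidableEq ι']

/-- **The lever on the cross space kills the forms `C₁, C₂`.**  If `(D + CL (t a))⁻¹ bL x` lies in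
`D⁻¹ (im bL)` (`t ≠ 0`), then `C₁(x) = C₂(x) = 0`. [folklore] -/
theorem cross_forms_vanish {D : Matrix ι' ι' k} (hDs : Dᵀ = D)
    (bL : (Fin 4 × Fin 4 → k) →ₗ[k] (ι' → k)) (CL : (Fin 4 × Fin 4 → k) →ₗ[k] Matrix ι' ι' k)
    (hCs : ∀ z, (CL z)ᵀ = CL z) {κ : k} (hκ : κ ≠ 0)
    (hii : ∀ z, bL z ⬝ᵥ (D⁻¹ * CL z * D⁻¹) *ᵥ bL z = 0)
    (hN : ∀ v, bL v = 0 → IsUnit (D + CL v).det ∧ ∀ (z : Fin 4 × Fin 4 → k) (s : k),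
      κ * MvPolynomial.eval (v + s • z) (perPoly (Fin 4) k) =
        (Matrix.fromBlocks ((s * 0) • (1 : Matrix Unit Unit k))
          (Matrix.replicateRow Unit (s • bL z)) (Matrix.replicateCol Unit (s • bL z))
          (D + CL v + s • CL z)).det)
    (hker : ∀ x : Fin 4 × Fin 4 → k,
      bL x = 0 ↔ ∀ z : Fin 4 × Fin 4, ¬ (z.1 = 0 ∨ z = (1, 0) ∨ z = (2, 0)) → x z = 0)
    (t : k) (ht : t ≠ 0) (x z₀ : Fin 4 × Fin 4 → k)
    (hx : (D + CL (t • fun z : Fin 4 × Fin 4 =>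
        (Matrix.of ![![0, 1, 1, 1], ![0, 0, 0, 0], ![0, 0, 0, 0], ![0, 0, 0, 0]]) z.1 z.2))⁻¹ *ᵥ
        bL x = D⁻¹ *ᵥ bL z₀)
    (i : Fin 4) (hi : i = 1 ∨ i = 2) :
    x (i, 1) * (x (3, 2) + x (3, 3)) + x (i, 2) * (x (3, 1) + x (3, 3)) +
      x (i, 3) * (x (3, 1) + x (3, 2)) = 0 := by
  set a : Fin 4 × Fin 4 → k := fun z =>
    (Matrix.of ![![0, 1, 1, 1], ![0, 0, 0, 0], ![0, 0, 0, 0], ![0, 0, 0, 0]]) z.1 z.2 with ha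
  have ha_ker : bL (t • a) = 0 :=
    (hker _).2 fun z hz => cross_a_off_row t z.1 z.2 fun h => hz (Or.inl h)
  have haff : ∀ z : Fin 4 × Fin 4 → k, ∃ e₀ e₁ : k, ∀ s : k,
      MvPolynomial.eval (z + s • (t • a)) (perPoly (Fin 4) k) = e₀ + s * e₁ := fun z =>
    affine_of_row k 0 (t • a) (fun i j hi => cross_a_off_row t i j hi) z
  have hshift : ∀ p q : k,
      MvPolynomial.eval (x + (fun z : Fin 4 × Fin 4 =>
          (Matrix.of ![![0, 0, 0, 0], ![p, 0, 0, 0], ![q, 0, 0, 0], ![0, 0, 0, 0]]) z.1 z.2) +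
          t • a) (perPoly (Fin 4) k) -
        MvPolynomial.eval (x + (fun z : Fin 4 × Fin 4 =>
          (Matrix.of ![![0, 0, 0, 0], ![p, 0, 0, 0], ![q, 0, 0, 0], ![0, 0, 0, 0]]) z.1 z.2))
          (perPoly (Fin 4) k) =
      MvPolynomial.eval (x + t • a) (perPoly (Fin 4) k) - MvPolynomial.eval x (perPoly (Fin 4) k) := by
    intro p q
    refine shift_invariance_of_affine hDs bL CL hCs hκ hii hN (t • a) ha_ker haff x z₀ hx _
      ((hker _).2 fun z hz => ?_)
    obtain ⟨i', j'⟩ := z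
    have h1 : ¬ i' = 0 := fun h => hz (Or.inl h)
    have h2 : ¬ (i', j') = (1, 0) := fun h => hz (Or.inr (Or.inl h))
    have h3 : ¬ (i', j') = (2, 0) := fun h => hz (Or.inr (Or.inr h))
    fin_cases i' <;> fin_cases j' <;> simp at h1 h2 h3 ⊢
  have key : ∀ p q : k, t * (p * (x (2, 1) * (x (3, 2) + x (3, 3)) +
      x (2, 2) * (x (3, 1) + x (3, 3)) + x (2, 3) * (x (3, 1) + x (3, 2))) +
      q * (x (1, 1) * (x (3, 2) + x (3, 3)) + x (1, 2) * (x (3, 1) + x (3, 3)) +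
      x (1, 3) * (x (3, 1) + x (3, 2)))) = 0 := by
    intro p q
    rw [← per_shift_cross x p q t, hshift p q, sub_self]
  rcases hi with rfl | rfl
  · have h := key 0 1
    rw [zero_mul, zero_add, one_mul] at h
    exact (mul_eq_zero.1 h).resolve_left ht
  · have h := key 1 0
    rw [one_mul, zero_mul, add_zero] at h
    exact (mul_eq_zero.1 h).resolve_left ht

omit [CharZero k] in
/-- A complement vector with `x₃' = 0` is the cross embedding of `(x₃₀, x|rows 1,2 × cols 1..3)`.
[folklore] -/
theorem eq_cross_of_rows_three (x : Fin 4 × Fin 4 → k)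
    (hX : ∀ z : Fin 4 × Fin 4, (z.1 = 0 ∨ z = (1, 0) ∨ z = (2, 0)) → x z = 0)
    (h3 : ∀ l : Fin 3, x (3, l.succ) = 0) :
    x = fun z : Fin 4 × Fin 4 => (Matrix.of ![![0, 0, 0, 0],
      ![0, x (1, 1), x (1, 2), x (1, 3)], ![0, x (2, 1), x (2, 2), x (2, 3)], ![x (3, 0), 0, 0, 0]])
      z.1 z.2 := by
  funext z
  obtain ⟨i, j⟩ := z
  have h31 := h3 0
  have h32 := h3 1
  have h33 := h3 2
  simp only [Fin.succ_zero_eq_one, Fin.succ_one_eq_two] at h31 h32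
  have h33' : x (3, 3) = 0 := h33
  fin_cases i <;> fin_cases j
  all_goals first
    | rfl
    | exact hX _ (by decide)
    | simpa using h31
    | simpa using h32
    | simpa using h33'

end Summit.ValiantsHypothesis.ValiantsHypothesis.Theorems.SymPencilPerFourCrossSixForms

end
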